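import Literature.AlgebraicGeometry.Resolution.AffineDomainDimension

/-!
# Crux `PicoverLocalModel` (stmt-ResolutionOfSingularities-0557), line `SketchIdeator3`
# (giraud-cossart-normal-form) — stub `stub_finiteDim`

A finitely generated domain over a field has finite Krull dimension (the dimension grading of the
line's residue `stub_cossartNormalForm`, stated per dimension `n`).
-/

set_option linter.dupNamespace false

namespace Summit.ResolutionOfSingularities.ResolutionOfSingularities.Theorems.PicoverLocalModel.FiniteDim

/-- **A finitely generated domain over a field has finite Krull dimension**: `dim R = trdeg_k R`
is a natural number (Noether normalisation; Matsumura Thm. 5.6, in tree as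
`Literature.AlgebraicGeometry.Resolution.exists_ringKrullDim_eq_and_trdeg_eq`). Registered stub
`stub_finiteDim` of the line `SketchIdeator3` of crux stmt-ResolutionOfSingularities-0557.
[cite: Matsumura1987, Thm. 5.6] -/
theorem stub_finiteDim : ∀ (k R : Type) [Field k] [CommRing R] [IsDomain R] [Algebra k R],
    Algebra.FiniteType k R → ∃ n : ℕ, ringKrullDim R ≤ n := by
  intro k R _ _ _ _ hft
  haveI := hft
  obtain ⟨n, hn, -⟩ :=
    Literature.AlgebraicGeometry.Resolution.exists_ringKrullDim_eq_and_trdeg_eq k R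
  exact ⟨n, hn.le⟩

end Summit.ResolutionOfSingularities.ResolutionOfSingularities.Theorems.PicoverLocalModel.FiniteDim
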